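import Literature.NumberTheory.Automorphic.OrbitalIntegralDoubleCosetUnfolding
import HarnessLib

/-!
# The orbital integral of `1_K` as a sum over the `K`-conjugacy classes inside `(G·γ) ∩ K`:
`O_γ(1_K) = Σ_{𝔠 ⊆ (G·γ) ∩ K} vol(K) / vol(K ∩ G_{γ_𝔠})`
(Laumon, *Cohomology of Drinfeld modular varieties* I (1996), Lemma (5.3.2); Rogawski (1990), §4.9 p. 54)

Topic `NumberTheory/Automorphic`; namespace `Literature.NumberTheory.Automorphic`. THEOREMS ONLY (no
definition, no instance, no named fact, no `sorry`). Sequel of ★ `OrbitalIntegralDoubleCosetUnfolding`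
(h2), which unfolds `∫⁻_{G ⧸ C} 1_K(y γ y⁻¹) d(ν/t)` (`C = C_G(γ)`, `K` compact open, `t` a Haar measure
on `C`, `ν` two-sided Haar on `G`) over the double cosets `K \ G / C` with weights
`ν(K) / t{c ∈ C | q.out c q.out⁻¹ ∈ K}`. Here that sum is RE-INDEXED by the `K`-CONJUGACY CLASSES inside
`(G·γ) ∩ K`, `I := {𝔠 : ConjClasses ↥K // ∃ k, ConjClasses.mk k = 𝔠 ∧ IsConj γ ↑k}`:

* §1 `conjClassesMk_conj_eq_iff` (`y γ y⁻¹ ~_K y' γ y'⁻¹ ↔ K y C = K y' C`), **(s1)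
  `bijective_conjClassesMk_doubleCoset`** (`{q ∈ K\G/C | q.out γ q.out⁻¹ ∈ K} → I`,
  `q ↦ [q.out γ q.out⁻¹]_K`, is bijective — `Function.Bijective` of the explicit map, no definition),
  `map_conj_centralizer_singleton` (`y C y⁻¹ = C_G(y γ y⁻¹)`);
* §2 the weight `t{c ∈ C | y c y⁻¹ ∈ K}` depends only on `K y C` ∕ on `[y γ y⁻¹]_K` (two-sided
  invariance of `t`: `measure_setOf_conj_mem_eq_of_doubleCoset_mk_eq`, `…_of_conjClassesMk_eq`) and is
  the mass of `K ∩ C_G(y γ y⁻¹)` for `t` transported along `c ↦ y c y⁻¹ : C ≃* C_G(y γ y⁻¹)`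
  (`measure_setOf_conj_mem_eq_map_conj`, Mathlib `MulEquiv.subgroupMap`∕`subgroupCongr` inline);
* §3 **(s2) `lintegral_descConj_indicator_quotientMeasure_eq_tsum_conjClasses`**: for any SECTION of
  representatives `y : I → G` (`[y 𝔠 γ (y 𝔠)⁻¹]_K = 𝔠`),
  `∫⁻_{G ⧸ C} 1_K(x γ x⁻¹) d(ν/t) = Σ'_{𝔠 : I} ν(K) / t{c ∈ C | y 𝔠 c (y 𝔠)⁻¹ ∈ K}`;
  `finite_conjClasses_meeting_of_isClosed` (`I` finite at a closed class); the named real form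
  **`orbitalIntegral_indicator_quotientMeasure_eq_sum_conjClasses`** over a `Fintype I`;
* §4 **(s4)** `γ ∈ K` and `(G·γ) ∩ K` a SINGLE `K`-class ⇒ `∫⁻ … = ν(K) / t(C ∩ K)`,
  `O_γ^{ν/t}(1_K) = (ν(K) / t(C ∩ K)).toReal`, `= 1` at `ν(K) = t(C ∩ K) = 1` (the unramified base case).

Conventions of ★ (B): LEFT cosets `y C`, `y γ y⁻¹` (print's `x⁻¹ γ x` under `y = x⁻¹`). NOT here:
`1_{K a K}`, the reduction of `K`-classes modulo `𝔭`.

## References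

* G. Laumon, *Cohomology of Drinfeld Modular Varieties*, Part I (1996), Lemma (5.3.2), p. 136 [Laumon1995].
* J. D. Rogawski, *Automorphic Representations of Unitary Groups in Three Variables* (1990), §4.9 p. 54
  [Rogawski1990].
-/

noncomputable section

open MeasureTheory Measure Topology Set Filter Function
open Literature.MeasureTheory.Group
open scoped ENNReal NNReal Pointwise

namespace Literature.NumberTheory.Automorphic

/-! ### §1 Algebra: double cosets `K y C_G(γ)` versus `K`-conjugacy classes in `(G·γ) ∩ K` -/

section Algebra

variable {G : Type*} [Group G] (γ : G) (K : Subgroup G)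

/-- Membership `y γ y⁻¹ ∈ K` depends only on the double coset `K y C_G(γ)`: if `K y C = K y' C` and
`y γ y⁻¹ ∈ K` then `y' γ y'⁻¹ = k (y γ y⁻¹) k⁻¹ ∈ K`. [cite: Laumon1995, Lemma (5.3.2) p. 136] -/
theorem conj_mem_of_doubleCoset_mk_eq {y y' : G}
    (hyy' : DoubleCoset.mk K (Subgroup.centralizer ({γ} : Set G)) y =
      DoubleCoset.mk K (Subgroup.centralizer ({γ} : Set G)) y')
    (h : y * γ * y⁻¹ ∈ K) : y' * γ * y'⁻¹ ∈ K := by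
  obtain ⟨k, hk, c, hc, rfl⟩ := (DoubleCoset.eq _ _ y y').1 hyy'
  have hcγ : c * γ * c⁻¹ = γ := by
    rw [Subgroup.mem_centralizer_singleton_iff.1 hc, mul_inv_cancel_right]
  have h1 : k * y * c * γ * (k * y * c)⁻¹ = k * (y * (c * γ * c⁻¹) * y⁻¹) * k⁻¹ := by group
  rw [h1, hcγ]
  exact K.mul_mem (K.mul_mem hk h) (K.inv_mem hk)

/-- For conjugates `y γ y⁻¹, y' γ y'⁻¹ ∈ K`: **they are conjugate IN `K` iff `K y C_G(γ) = K y' C_G(γ)`**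
(`k (y γ y⁻¹) k⁻¹ = y' γ y'⁻¹ ⇔ y'⁻¹ k y ∈ C_G(γ) ⇔ y' ∈ K y C_G(γ)`). [cite: Laumon1995, Lemma (5.3.2) p. 136] -/
theorem conjClassesMk_conj_eq_iff {y y' : G} (h : y * γ * y⁻¹ ∈ K) (h' : y' * γ * y'⁻¹ ∈ K) :
    ConjClasses.mk (⟨y * γ * y⁻¹, h⟩ : K) = ConjClasses.mk (⟨y' * γ * y'⁻¹, h'⟩ : K) ↔
      DoubleCoset.mk K (Subgroup.centralizer ({γ} : Set G)) y =
        DoubleCoset.mk K (Subgroup.centralizer ({γ} : Set G)) y' := by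
  rw [ConjClasses.mk_eq_mk_iff_isConj, isConj_iff, DoubleCoset.eq]
  constructor
  · rintro ⟨⟨k, hk⟩, hkconj⟩
    have hG : k * (y * γ * y⁻¹) * k⁻¹ = y' * γ * y'⁻¹ := by
      have h1 := congrArg Subtype.val hkconj
      simpa only [Subgroup.coe_mul, Subgroup.coe_inv] using h1
    refine ⟨k, hk, (y'⁻¹ * (k * y))⁻¹, Subgroup.inv_mem _ ?_, by group⟩
    rw [Subgroup.mem_centralizer_singleton_iff]
    have h2 : y'⁻¹ * (k * (y * γ * y⁻¹) * k⁻¹) * y' = γ := by rw [hG]; group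
    calc y'⁻¹ * (k * y) * γ = y'⁻¹ * (k * (y * γ * y⁻¹) * k⁻¹) * y' * (y'⁻¹ * (k * y)) := by group
      _ = γ * (y'⁻¹ * (k * y)) := by rw [h2]
  · rintro ⟨k, hk, c, hc, hy'⟩
    subst hy'
    refine ⟨⟨k, hk⟩, Subtype.ext ?_⟩
    simp only [Subgroup.coe_mul, Subgroup.coe_inv]
    have hcγ : c * γ * c⁻¹ = γ := by
      rw [Subgroup.mem_centralizer_singleton_iff.1 hc, mul_inv_cancel_right]
    calc k * (y * γ * y⁻¹) * k⁻¹ = k * (y * (c * γ * c⁻¹) * y⁻¹) * k⁻¹ := by rw [hcγ]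
      _ = k * y * c * γ * (k * y * c)⁻¹ := by group

/-- Any conjugate `y γ y⁻¹` lying in `K` defines a `K`-class inside `(G·γ) ∩ K`. [cite: Laumon1995, Lemma (5.3.2) p. 136] -/
theorem exists_mk_eq_and_isConj {y : G} (h : y * γ * y⁻¹ ∈ K) :
    ∃ k : K, ConjClasses.mk k = ConjClasses.mk (⟨y * γ * y⁻¹, h⟩ : K) ∧ IsConj γ (k : G) :=
  ⟨⟨y * γ * y⁻¹, h⟩, rfl, isConj_iff.2 ⟨y, rfl⟩⟩

/-- **(s1) The bijection `{q ∈ K\G/C_G(γ) | q.out γ q.out⁻¹ ∈ K} ≃ {K-classes inside (G·γ) ∩ K}`**,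
`q ↦ [q.out γ q.out⁻¹]_K`, stated as bijectivity of the explicit map (injective by
`conjClassesMk_conj_eq_iff`; surjective: a class `[k]_K` with `k = c γ c⁻¹` is hit by `q = K c C`).
With ★ (h2) this turns the fixed-point sum into a sum over `K`-conjugacy classes.
[cite: Laumon1995, Lemma (5.3.2) p. 136] -/
theorem bijective_conjClassesMk_doubleCoset :
    Function.Bijective
      (fun q : {q : DoubleCoset.Quotient (K : Set G) (Subgroup.centralizer ({γ} : Set G) : Set G) //
          q.out * γ * q.out⁻¹ ∈ K} =>
        (⟨ConjClasses.mk (⟨q.1.out * γ * q.1.out⁻¹, q.2⟩ : K), exists_mk_eq_and_isConj γ K q.2⟩ :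
          {𝔠 : ConjClasses K // ∃ k : K, ConjClasses.mk k = 𝔠 ∧ IsConj γ (k : G)})) := by
  constructor
  · rintro ⟨q, hq⟩ ⟨q', hq'⟩ hqq'
    have h1 : ConjClasses.mk (⟨q.out * γ * q.out⁻¹, hq⟩ : K) =
        ConjClasses.mk (⟨q'.out * γ * q'.out⁻¹, hq'⟩ : K) := congrArg Subtype.val hqq'
    have h2 := (conjClassesMk_conj_eq_iff γ K hq hq').1 h1
    rw [DoubleCoset.out_eq', DoubleCoset.out_eq'] at h2
    exact Subtype.ext h2
  · rintro ⟨𝔠, k, hk𝔠, hconj⟩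
    obtain ⟨c, hc⟩ := isConj_iff.1 hconj
    have hcK : c * γ * c⁻¹ ∈ K := by rw [hc]; exact k.2
    set q : DoubleCoset.Quotient (K : Set G) (Subgroup.centralizer ({γ} : Set G) : Set G) :=
      DoubleCoset.mk K (Subgroup.centralizer ({γ} : Set G)) c with hqdef
    have hqc : DoubleCoset.mk K (Subgroup.centralizer ({γ} : Set G)) c =
        DoubleCoset.mk K (Subgroup.centralizer ({γ} : Set G)) q.out := by
      rw [DoubleCoset.out_eq']
    have hq : q.out * γ * q.out⁻¹ ∈ K := conj_mem_of_doubleCoset_mk_eq γ K hqc hcK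
    refine ⟨⟨q, hq⟩, Subtype.ext ?_⟩
    show ConjClasses.mk (⟨q.out * γ * q.out⁻¹, hq⟩ : K) = 𝔠
    rw [← hk𝔠]
    have hk : ConjClasses.mk (⟨c * γ * c⁻¹, hcK⟩ : K) = ConjClasses.mk k := by
      congr 1
      exact Subtype.ext hc
    rw [← hk]
    exact (conjClassesMk_conj_eq_iff γ K hq hcK).2 hqc.symm

/-- `y C_G(γ) y⁻¹ = C_G(y γ y⁻¹)`: the image of the centraliser under conjugation by `y` is the
centraliser of the conjugate. [cite: Rogawski1990, §4.9 p. 54] -/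
theorem map_conj_centralizer_singleton (y : G) :
    (Subgroup.centralizer ({γ} : Set G)).map (MulAut.conj y : G →* G) =
      Subgroup.centralizer ({y * γ * y⁻¹} : Set G) := by
  ext g
  rw [Subgroup.mem_map, Subgroup.mem_centralizer_singleton_iff]
  constructor
  · rintro ⟨c, hc, rfl⟩
    rw [Subgroup.mem_centralizer_singleton_iff] at hc
    show y * c * y⁻¹ * (y * γ * y⁻¹) = y * γ * y⁻¹ * (y * c * y⁻¹)
    calc y * c * y⁻¹ * (y * γ * y⁻¹) = y * (c * γ) * y⁻¹ := by group
      _ = y * (γ * c) * y⁻¹ := by rw [hc]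
      _ = y * γ * y⁻¹ * (y * c * y⁻¹) := by group
  · intro hg
    refine ⟨y⁻¹ * g * y, ?_, ?_⟩
    · rw [Subgroup.mem_centralizer_singleton_iff]
      calc y⁻¹ * g * y * γ = y⁻¹ * (g * (y * γ * y⁻¹)) * y := by group
        _ = y⁻¹ * ((y * γ * y⁻¹) * g) * y := by rw [hg]
        _ = γ * (y⁻¹ * g * y) := by group
    · show y * (y⁻¹ * g * y) * y⁻¹ = g
      group

end Algebra

/-! ### §2 The weights `t{c ∈ C_G(γ) | y c y⁻¹ ∈ K}` are class functions -/

section Weight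

variable {G : Type*} [Group G] [TopologicalSpace G] [IsTopologicalGroup G] [MeasurableSpace G]
  [BorelSpace G] (γ : G) (K : Subgroup G)
  (t : Measure (Subgroup.centralizer ({γ} : Set G))) [t.IsMulLeftInvariant] [t.IsInvInvariant]

/-- **The weight depends only on the double coset**: for `K y C = K y' C` (`C = C_G(γ)`) and a
left-invariant, inversion-invariant (hence two-sided) measure `t` on `C`,
`t{c ∈ C | y c y⁻¹ ∈ K} = t{c ∈ C | y' c y'⁻¹ ∈ K}` — with `y' = k y c₀` the second set is the
conjugate `c₀⁻¹ {…} c₀` of the first inside `C`. [cite: Laumon1995, Lemma (5.3.2) p. 136] -/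
theorem measure_setOf_conj_mem_eq_of_doubleCoset_mk_eq {y y' : G}
    (hyy' : DoubleCoset.mk K (Subgroup.centralizer ({γ} : Set G)) y =
      DoubleCoset.mk K (Subgroup.centralizer ({γ} : Set G)) y') :
    t {c : Subgroup.centralizer ({γ} : Set G) | y * (c : G) * y⁻¹ ∈ K} =
      t {c : Subgroup.centralizer ({γ} : Set G) | y' * (c : G) * y'⁻¹ ∈ K} := by
  obtain ⟨k, hk, c₀, hc₀, rfl⟩ := (DoubleCoset.eq _ _ y y').1 hyy'
  haveI : t.IsMulRightInvariant := by
    rw [← Measure.inv_eq_self t]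
    infer_instance
  have hset : {c : Subgroup.centralizer ({γ} : Set G) | k * y * c₀ * (c : G) * (k * y * c₀)⁻¹ ∈ K} =
      (fun c => (⟨c₀, hc₀⟩ : Subgroup.centralizer ({γ} : Set G)) * c) ⁻¹'
        ((fun c => c * (⟨c₀, hc₀⟩ : Subgroup.centralizer ({γ} : Set G))⁻¹) ⁻¹'
          {c : Subgroup.centralizer ({γ} : Set G) | y * (c : G) * y⁻¹ ∈ K}) := by
    ext c
    simp only [Set.mem_setOf_eq, Set.mem_preimage, Subgroup.coe_mul, Subgroup.coe_inv]
    have h1 : k * y * c₀ * (c : G) * (k * y * c₀)⁻¹ = k * (y * (c₀ * c * c₀⁻¹) * y⁻¹) * k⁻¹ := by group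
    rw [h1, Subgroup.mul_mem_cancel_right K (K.inv_mem hk), Subgroup.mul_mem_cancel_left K hk]
  rw [hset, measure_preimage_mul, measure_preimage_mul_right]

/-- **The weight is a function of the `K`-class of `y γ y⁻¹`**: if `y γ y⁻¹, y' γ y'⁻¹ ∈ K` are
`K`-conjugate then `t{c | y c y⁻¹ ∈ K} = t{c | y' c y'⁻¹ ∈ K}`. [cite: Laumon1995, Lemma (5.3.2) p. 136] -/
theorem measure_setOf_conj_mem_eq_of_conjClassesMk_eq {y y' : G} (h : y * γ * y⁻¹ ∈ K)
    (h' : y' * γ * y'⁻¹ ∈ K)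
    (hcls : ConjClasses.mk (⟨y * γ * y⁻¹, h⟩ : K) = ConjClasses.mk (⟨y' * γ * y'⁻¹, h'⟩ : K)) :
    t {c : Subgroup.centralizer ({γ} : Set G) | y * (c : G) * y⁻¹ ∈ K} =
      t {c : Subgroup.centralizer ({γ} : Set G) | y' * (c : G) * y'⁻¹ ∈ K} :=
  measure_setOf_conj_mem_eq_of_doubleCoset_mk_eq γ K t ((conjClassesMk_conj_eq_iff γ K h h').1 hcls)

omit [t.IsMulLeftInvariant] [t.IsInvInvariant] in
/-- **The weight is a transported centraliser mass**: `t{c ∈ C_G(γ) | y c y⁻¹ ∈ K}` is the mass of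
`K ∩ C_G(y γ y⁻¹)` for the image of `t` under the isomorphism `c ↦ y c y⁻¹ : C_G(γ) ≃* C_G(y γ y⁻¹)`
(Mathlib `MulEquiv.subgroupMap (MulAut.conj y)` followed by `MulEquiv.subgroupCongr`) — print's
`vol(K ∩ G_δ, dg_δ)` for the measure `dg_δ` on `G_δ`, `δ = y γ y⁻¹`, compatible with `dg_γ = t`.
[cite: Laumon1995, Lemma (5.3.2) p. 136] -/
theorem measure_setOf_conj_mem_eq_map_conj (hK : MeasurableSet (K : Set G)) (y : G) :
    t {c : Subgroup.centralizer ({γ} : Set G) | y * (c : G) * y⁻¹ ∈ K} =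
      Measure.map
        (⇑(((MulAut.conj y).subgroupMap (Subgroup.centralizer ({γ} : Set G))).trans
          (MulEquiv.subgroupCongr (map_conj_centralizer_singleton γ y))))
        t (Subtype.val ⁻¹' (K : Set G)) := by
  set e := ((MulAut.conj y).subgroupMap (Subgroup.centralizer ({γ} : Set G))).trans
    (MulEquiv.subgroupCongr (map_conj_centralizer_singleton γ y)) with he
  have hval : (Subtype.val ∘ ⇑e) = fun c : Subgroup.centralizer ({γ} : Set G) => y * (c : G) * y⁻¹ := by
    funext c
    rfl
  have hcont : Continuous ⇑e := by
    rw [continuous_induced_rng, hval]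
    exact (continuous_const.mul continuous_subtype_val).mul continuous_const
  rw [Measure.map_apply hcont.measurable (hK.preimage measurable_subtype_coe), ← Set.preimage_comp,
    hval]
  rfl

end Weight

/-! ### §3 (s2) The sum over the `K`-conjugacy classes inside `(G·γ) ∩ K` -/

section Classes

variable {G : Type*} [Group G] [TopologicalSpace G] [IsTopologicalGroup G] [LocallyCompactSpace G]
  [SecondCountableTopology G] [T2Space G] [MeasurableSpace G] [BorelSpace G]
  (γ : G) (K : Subgroup G)
  [MeasurableSpace (G ⧸ Subgroup.centralizer ({γ} : Set G))]
  [BorelSpace (G ⧸ Subgroup.centralizer ({γ} : Set G))]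
  [hC : IsClosed ((Subgroup.centralizer ({γ} : Set G) : Subgroup G) : Set G)]
  (t : Measure (Subgroup.centralizer ({γ} : Set G))) [t.IsMulLeftInvariant]
  [IsFiniteMeasureOnCompacts t] [t.IsOpenPosMeasure] [t.IsInvInvariant] [SFinite t]
  (ν : Measure G) [IsHaarMeasure ν] [ν.IsMulRightInvariant]

/-- **(s2) The orbital integral of `1_K` as a sum over the `K`-classes inside `(G·γ) ∩ K`.**
For `K` compact open and ANY section of representatives `y : I → G` of the `K`-conjugacy classes
`I = {𝔠 : ConjClasses ↥K // ∃ k, ConjClasses.mk k = 𝔠 ∧ IsConj γ ↑k}` inside `(G·γ) ∩ K`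
(`[y 𝔠 γ (y 𝔠)⁻¹]_K = 𝔠`):
`∫⁻_{G ⧸ C_G(γ)} 1_K(x γ x⁻¹) d(ν/t)(x) = Σ'_{𝔠 : I} ν(K) / t{c ∈ C_G(γ) | y 𝔠 c (y 𝔠)⁻¹ ∈ K}`
— ★ (h2) re-indexed along the bijection (s1), the weights being class functions (§2).
[cite: Laumon1995, Lemma (5.3.2) p. 136] -/
theorem lintegral_descConj_indicator_quotientMeasure_eq_tsum_conjClasses (hK : IsOpen (K : Set G))
    (hKc : IsCompact (K : Set G))
    (y : {𝔠 : ConjClasses K // ∃ k : K, ConjClasses.mk k = 𝔠 ∧ IsConj γ (k : G)} → G)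
    (hy : ∀ 𝔠, ∃ h : y 𝔠 * γ * (y 𝔠)⁻¹ ∈ K, ConjClasses.mk (⟨y 𝔠 * γ * (y 𝔠)⁻¹, h⟩ : K) = 𝔠.1) :
    ∫⁻ x, descConj γ (Subgroup.centralizer ({γ} : Set G))
        (fun _ hg => Subgroup.mem_centralizer_singleton_iff.1 hg)
          ((K : Set G).indicator (1 : G → ℝ≥0∞)) x
          ∂quotientMeasure (Subgroup.centralizer ({γ} : Set G)) t hC ν =
      ∑' 𝔠 : {𝔠 : ConjClasses K // ∃ k : K, ConjClasses.mk k = 𝔠 ∧ IsConj γ (k : G)},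
        ν K / t {c : Subgroup.centralizer ({γ} : Set G) | y 𝔠 * (c : G) * (y 𝔠)⁻¹ ∈ K} := by
  rw [lintegral_descConj_indicator_quotientMeasure_eq_tsum γ K t ν hK hKc]
  -- the map `𝔠 ↦ K (y 𝔠) C` is injective and its range carries the support of the summand
  set g : {𝔠 : ConjClasses K // ∃ k : K, ConjClasses.mk k = 𝔠 ∧ IsConj γ (k : G)} →
      DoubleCoset.Quotient (K : Set G) (Subgroup.centralizer ({γ} : Set G) : Set G) :=
    fun 𝔠 => DoubleCoset.mk K (Subgroup.centralizer ({γ} : Set G)) (y 𝔠) with hgdef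
  have hg : Function.Injective g := by
    intro 𝔠 𝔠' h𝔠
    obtain ⟨hm, hcls⟩ := hy 𝔠
    obtain ⟨hm', hcls'⟩ := hy 𝔠'
    apply Subtype.ext
    rw [← hcls, ← hcls']
    exact (conjClassesMk_conj_eq_iff γ K hm hm').2 h𝔠
  have hsupp : Function.support (fun q : DoubleCoset.Quotient (K : Set G)
        (Subgroup.centralizer ({γ} : Set G) : Set G) =>
      (K : Set G).indicator (1 : G → ℝ≥0∞) (q.out * γ * q.out⁻¹) *
        (ν K / t {c : Subgroup.centralizer ({γ} : Set G) | (q.out : G) * (c : G) * q.out⁻¹ ∈ K})) ⊆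
      Set.range g := by
    intro q hq
    rw [Function.mem_support] at hq
    have hqK : q.out * γ * q.out⁻¹ ∈ K := by
      by_contra hnot
      exact hq (by rw [Set.indicator_of_notMem (show q.out * γ * q.out⁻¹ ∉ (K : Set G) from hnot),
        zero_mul])
    set 𝔠₀ : {𝔠 : ConjClasses K // ∃ k : K, ConjClasses.mk k = 𝔠 ∧ IsConj γ (k : G)} :=
      ⟨ConjClasses.mk (⟨q.out * γ * q.out⁻¹, hqK⟩ : K), exists_mk_eq_and_isConj γ K hqK⟩ with h𝔠₀
    obtain ⟨hm, hcls⟩ := hy 𝔠₀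
    refine ⟨𝔠₀, ?_⟩
    show DoubleCoset.mk K (Subgroup.centralizer ({γ} : Set G)) (y 𝔠₀) = q
    rw [← DoubleCoset.out_eq' K (Subgroup.centralizer ({γ} : Set G)) q]
    exact (conjClassesMk_conj_eq_iff γ K hm hqK).1 hcls
  rw [← hg.tsum_eq hsupp]
  refine tsum_congr fun 𝔠 => ?_
  obtain ⟨hm, hcls⟩ := hy 𝔠
  -- the representative `(K (y 𝔠) C).out` lies in the same double coset as `y 𝔠`
  have hdc : DoubleCoset.mk K (Subgroup.centralizer ({γ} : Set G)) (y 𝔠) =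
      DoubleCoset.mk K (Subgroup.centralizer ({γ} : Set G)) (g 𝔠).out := by
    rw [hgdef, DoubleCoset.out_eq']
  have hmem : (g 𝔠).out * γ * (g 𝔠).out⁻¹ ∈ K := conj_mem_of_doubleCoset_mk_eq γ K hdc hm
  show (K : Set G).indicator (1 : G → ℝ≥0∞) ((g 𝔠).out * γ * (g 𝔠).out⁻¹) *
      (ν K / t {c : Subgroup.centralizer ({γ} : Set G) | ((g 𝔠).out : G) * (c : G) * (g 𝔠).out⁻¹ ∈ K}) =
    ν K / t {c : Subgroup.centralizer ({γ} : Set G) | y 𝔠 * (c : G) * (y 𝔠)⁻¹ ∈ K}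
  rw [Set.indicator_of_mem (show (g 𝔠).out * γ * (g 𝔠).out⁻¹ ∈ (K : Set G) from hmem), Pi.one_apply,
    one_mul, measure_setOf_conj_mem_eq_of_doubleCoset_mk_eq γ K t hdc]

omit [MeasurableSpace G] [BorelSpace G] [MeasurableSpace (G ⧸ Subgroup.centralizer ({γ} : Set G))]
  [BorelSpace (G ⧸ Subgroup.centralizer ({γ} : Set G))] hC in
/-- **At a closed class there are finitely many `K`-classes inside `(G·γ) ∩ K`** (`K` compact open):
★ `finite_setOf_conj_out_ne_zero_of_isClosed` and the bijection (s1) (Laumon (1996), Lemma (5.3.2):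
«there are finitely many `G_γ(F)`-orbits …»). [cite: Laumon1995, Lemma (5.3.2) p. 136] -/
theorem finite_conjClasses_meeting_of_isClosed (hO : IsClosed {g | ∃ y : G, y * γ * y⁻¹ = g})
    (hK : IsOpen (K : Set G)) (hKc : IsCompact (K : Set G)) :
    Finite {𝔠 : ConjClasses K // ∃ k : K, ConjClasses.mk k = 𝔠 ∧ IsConj γ (k : G)} := by
  have hfs : HasCompactSupport ((K : Set G).indicator (1 : G → ℝ)) :=
    HasCompactSupport.intro hKc fun g hg => Set.indicator_of_notMem hg _
  have hfin := finite_setOf_conj_out_ne_zero_of_isClosed γ K hO hK hfs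
  have hset : {q : DoubleCoset.Quotient (K : Set G) (Subgroup.centralizer ({γ} : Set G) : Set G) |
      (K : Set G).indicator (1 : G → ℝ) (q.out * γ * q.out⁻¹) ≠ 0} =
      {q | q.out * γ * q.out⁻¹ ∈ K} := by
    ext q
    simp only [Set.mem_setOf_eq, ne_eq, Set.indicator_apply_eq_zero, Pi.one_apply, one_ne_zero,
      imp_false, not_not, SetLike.mem_coe]
  rw [hset] at hfin
  haveI : Finite {q : DoubleCoset.Quotient (K : Set G) (Subgroup.centralizer ({γ} : Set G) : Set G) //
      q.out * γ * q.out⁻¹ ∈ K} := hfin.to_subtype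
  exact Finite.of_surjective _ (bijective_conjClassesMk_doubleCoset γ K).2

omit [LocallyCompactSpace G] [SecondCountableTopology G] [T2Space G] hC in
/-- The real orbital integral of `1_K` is the real part of the `[0, ∞]`-valued one:
`O_γ^m(1_K) = (∫⁻ 1_K(x γ x⁻¹) dm).toReal` (the integrand is a non-negative indicator).
[cite: Rogawski1990, §4.9 p. 54] -/
theorem orbitalIntegral_indicator_eq_toReal_lintegral (hK : IsOpen (K : Set G))
    (m : Measure (G ⧸ Subgroup.centralizer ({γ} : Set G))) :
    orbitalIntegral γ ((K : Set G).indicator (1 : G → ℝ)) m =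
      (∫⁻ x, descConj γ (Subgroup.centralizer ({γ} : Set G))
        (fun _ hg => Subgroup.mem_centralizer_singleton_iff.1 hg)
          ((K : Set G).indicator (1 : G → ℝ≥0∞)) x ∂m).toReal := by
  rw [orbitalIntegral_eq_integral_descConj, integral_eq_lintegral_of_nonneg_ae]
  · congr 1
    refine lintegral_congr fun x => ?_
    induction x using QuotientGroup.induction_on with
    | H g =>
      rw [descConj_mk, descConj_mk]
      by_cases hg : g * γ * g⁻¹ ∈ (K : Set G)
      · rw [Set.indicator_of_mem hg, Set.indicator_of_mem hg, Pi.one_apply, Pi.one_apply,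
          ENNReal.ofReal_one]
      · rw [Set.indicator_of_notMem hg, Set.indicator_of_notMem hg, ENNReal.ofReal_zero]
  · refine Eventually.of_forall fun x => ?_
    induction x using QuotientGroup.induction_on with
    | H g =>
      rw [Pi.zero_apply, descConj_mk]
      exact Set.indicator_nonneg (fun _ _ => zero_le_one) _
  · exact (measurable_descConj γ _ _ (measurable_one.indicator hK.measurableSet)).aestronglyMeasurable

/-- **(s2, named real form) `O_γ^{ν/t}(1_K) = Σ_{𝔠} ν(K) / t{c | y 𝔠 c (y 𝔠)⁻¹ ∈ K}`** over the
(finitely many, `Fintype` — e.g. `Fintype.ofFinite` from `finite_conjClasses_meeting_of_isClosed`)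
`K`-classes inside `(G·γ) ∩ K`, for any section of representatives `y`.
[cite: Laumon1995, Lemma (5.3.2) p. 136] -/
theorem orbitalIntegral_indicator_quotientMeasure_eq_sum_conjClasses
    [Fintype {𝔠 : ConjClasses K // ∃ k : K, ConjClasses.mk k = 𝔠 ∧ IsConj γ (k : G)}]
    (hK : IsOpen (K : Set G)) (hKc : IsCompact (K : Set G))
    (y : {𝔠 : ConjClasses K // ∃ k : K, ConjClasses.mk k = 𝔠 ∧ IsConj γ (k : G)} → G)
    (hy : ∀ 𝔠, ∃ h : y 𝔠 * γ * (y 𝔠)⁻¹ ∈ K, ConjClasses.mk (⟨y 𝔠 * γ * (y 𝔠)⁻¹, h⟩ : K) = 𝔠.1) :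
    orbitalIntegral γ ((K : Set G).indicator (1 : G → ℝ))
        (quotientMeasure (Subgroup.centralizer ({γ} : Set G)) t hC ν) =
      ∑ 𝔠 : {𝔠 : ConjClasses K // ∃ k : K, ConjClasses.mk k = 𝔠 ∧ IsConj γ (k : G)},
        (ν K / t {c : Subgroup.centralizer ({γ} : Set G) | y 𝔠 * (c : G) * (y 𝔠)⁻¹ ∈ K}).toReal := by
  rw [orbitalIntegral_indicator_eq_toReal_lintegral γ K hK,
    lintegral_descConj_indicator_quotientMeasure_eq_tsum_conjClasses γ K t ν hK hKc y hy, tsum_fintype,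
    ENNReal.toReal_sum]
  exact fun 𝔠 _ =>
    (ENNReal.div_lt_top hKc.measure_lt_top.ne (measure_setOf_conj_mem_pos γ K t hK (y 𝔠)).ne').ne

/-! ### §4 (s4) A single `K`-class: the unramified base case -/

/-- **(s4) If `γ ∈ K` and `(G·γ) ∩ K` is a single `K`-conjugacy class** (every `g γ g⁻¹ ∈ K` is
`K`-conjugate to `γ`), then only the double coset `K·1·C` contributes:
`∫⁻_{G ⧸ C} 1_K(x γ x⁻¹) d(ν/t) = ν(K) / t(C ∩ K)` (`C = C_G(γ)`).
[cite: Laumon1995, Lemma (5.3.2) p. 136] -/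
theorem lintegral_descConj_indicator_quotientMeasure_eq_of_single_conjClass (hK : IsOpen (K : Set G))
    (hKc : IsCompact (K : Set G)) (hγ : γ ∈ K)
    (h1 : ∀ g : G, g * γ * g⁻¹ ∈ K → ∃ k ∈ K, k * γ * k⁻¹ = g * γ * g⁻¹) :
    ∫⁻ x, descConj γ (Subgroup.centralizer ({γ} : Set G))
        (fun _ hg => Subgroup.mem_centralizer_singleton_iff.1 hg)
          ((K : Set G).indicator (1 : G → ℝ≥0∞)) x
          ∂quotientMeasure (Subgroup.centralizer ({γ} : Set G)) t hC ν =
      ν K / t {c : Subgroup.centralizer ({γ} : Set G) | (c : G) ∈ K} := by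
  rw [lintegral_descConj_indicator_quotientMeasure_eq_tsum γ K t ν hK hKc]
  have hγ1 : (1 : G) * γ * 1⁻¹ ∈ K := by simpa only [one_mul, inv_one, mul_one] using hγ
  -- every contributing class is the class of `1`
  have hcls : ∀ q : DoubleCoset.Quotient (K : Set G) (Subgroup.centralizer ({γ} : Set G) : Set G),
      q.out * γ * q.out⁻¹ ∈ K → q = DoubleCoset.mk K (Subgroup.centralizer ({γ} : Set G)) 1 := by
    intro q hq
    obtain ⟨k, hk, hkγ⟩ := h1 q.out hq
    have hkK : k * γ * k⁻¹ ∈ K := K.mul_mem (K.mul_mem hk hγ) (K.inv_mem hk)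
    have hqk : ConjClasses.mk (⟨q.out * γ * q.out⁻¹, hq⟩ : K) = ConjClasses.mk (⟨k * γ * k⁻¹, hkK⟩ : K) := by
      congr 1
      exact Subtype.ext hkγ.symm
    have h2 := (conjClassesMk_conj_eq_iff γ K hq hkK).1 hqk
    rw [DoubleCoset.out_eq'] at h2
    rw [h2, DoubleCoset.eq]
    exact ⟨k⁻¹, K.inv_mem hk, 1, Subgroup.one_mem _, by group⟩
  rw [tsum_eq_single (DoubleCoset.mk K (Subgroup.centralizer ({γ} : Set G)) 1)]
  · have hdc : DoubleCoset.mk K (Subgroup.centralizer ({γ} : Set G)) 1 =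
        DoubleCoset.mk K (Subgroup.centralizer ({γ} : Set G))
          (DoubleCoset.mk K (Subgroup.centralizer ({γ} : Set G)) (1 : G) :
            DoubleCoset.Quotient (K : Set G) (Subgroup.centralizer ({γ} : Set G) : Set G)).out := by
      rw [DoubleCoset.out_eq']
    have hmem := conj_mem_of_doubleCoset_mk_eq γ K hdc hγ1
    rw [Set.indicator_of_mem (show _ ∈ (K : Set G) from hmem), Pi.one_apply, one_mul,
      ← measure_setOf_conj_mem_eq_of_doubleCoset_mk_eq γ K t hdc]
    simp only [one_mul, inv_one, mul_one]
  · intro q hq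
    rw [Set.indicator_of_notMem, zero_mul]
    exact fun hmem => hq (hcls q hmem)

/-- **(s4, named real form) `O_γ^{ν/t}(1_K) = (ν(K) / t(C_G(γ) ∩ K)).toReal`** when `γ ∈ K` and
`(G·γ) ∩ K` is a single `K`-class. [cite: Laumon1995, Lemma (5.3.2) p. 136] -/
theorem orbitalIntegral_indicator_quotientMeasure_eq_of_single_conjClass (hK : IsOpen (K : Set G))
    (hKc : IsCompact (K : Set G)) (hγ : γ ∈ K)
    (h1 : ∀ g : G, g * γ * g⁻¹ ∈ K → ∃ k ∈ K, k * γ * k⁻¹ = g * γ * g⁻¹) :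
    orbitalIntegral γ ((K : Set G).indicator (1 : G → ℝ))
        (quotientMeasure (Subgroup.centralizer ({γ} : Set G)) t hC ν) =
      (ν K / t {c : Subgroup.centralizer ({γ} : Set G) | (c : G) ∈ K}).toReal := by
  rw [orbitalIntegral_indicator_eq_toReal_lintegral γ K hK,
    lintegral_descConj_indicator_quotientMeasure_eq_of_single_conjClass γ K t ν hK hKc hγ h1]

/-- **(s4, normalised) `O_γ^{ν/t}(1_K) = 1`** when `γ ∈ K`, `(G·γ) ∩ K` is a single `K`-class and the
measures are normalised by `ν(K) = 1`, `t(C_G(γ) ∩ K) = 1` — the unramified base case of the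
fundamental-lemma computations. [cite: Laumon1995, Lemma (5.3.2) p. 136] -/
theorem orbitalIntegral_indicator_quotientMeasure_eq_one_of_single_conjClass (hK : IsOpen (K : Set G))
    (hKc : IsCompact (K : Set G)) (hγ : γ ∈ K)
    (h1 : ∀ g : G, g * γ * g⁻¹ ∈ K → ∃ k ∈ K, k * γ * k⁻¹ = g * γ * g⁻¹) (hν : ν K = 1)
    (ht : t {c : Subgroup.centralizer ({γ} : Set G) | (c : G) ∈ K} = 1) :
    orbitalIntegral γ ((K : Set G).indicator (1 : G → ℝ))
        (quotientMeasure (Subgroup.centralizer ({γ} : Set G)) t hC ν) = 1 := by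
  rw [orbitalIntegral_indicator_quotientMeasure_eq_of_single_conjClass γ K t ν hK hKc hγ h1, hν, ht,
    div_one, ENNReal.toReal_one]

end Classes

end Literature.NumberTheory.Automorphic
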